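import Mathlib
import HarnessLib
import HarnessLib.Audit
import Summits.Parity.Statement
import Literature.NumberTheory.LFunctions.GaussianPrimesInSectors

/-!
Route: NeedleSectors

CLOSED (retired) 2026-08-15T13:50:09Z by operator:999:1257524 — reason: not-a-thesis: assembly does not conclude the sub-problem Statement — note: D-0027 §2.1 audit (human 2026-08-15: routes that do not decide the summit are removed): the assembly concludes `NeedleFamilyHalf ∧ NeedleFamilyFat ∧ NeedleFixed`, not the sub-problem statement; a NEW conforming route may be opened from the same idea (generated `closes : … → _root_.BatemanHorn`).. The file is kept as the record of this route; refuted decls are indexed as negative knowledge (`ledger negatives`).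

# Route NeedleSectors — needle family = almost-all sectors at exponent ≤ 1/2 — Hecke-character mean
square for μ∘N plus SL₂ direction discretisation closes 0883/0884/0885

ENGINE ROUTE (realises card needle-family-is-almost-all-sectors) for three filed items of
route-Parity-UnimodularColumns: NeedleFamilyHalf (stmt-Parity-0883, there a rank-3 crux),
NeedleFamilyFat (stmt-Parity-0884) and NeedleFixed (stmt-Parity-0885), re-filed here verbatim so the
ledger shares them. It suffices to show X = X1 ∧ X2 with X1 = SectorMobiusMeanSquare: for every
smooth radial bump Φ supported in [1/2, 3], Σ_{0 ≤ k ≤ X^{11/20}} |Σ_{z ∈ ℤ[i]} μ(N z) Φ(N z/X)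
λ^k(z)|² = o(X²) (λ^k(z) = (z/|z|)^{4k} the angular Hecke characters; the μ∘N analogue of
Huang–Liu–Rudnick's variance theorem, exponent 11/20 < 3/5), and X2 = NeedleReductionHalf: X1 →
NeedleFamilyHalf (every SL₂ needle γ(B_√N), ‖γ‖² = M ≤ N, is at every norm scale X a sector of
angular half-width √(N/(M·X)) ≥ X^{-1/2}, i.e. exponent ρ ≤ 1/2; the L¹ average over the ≍ M
directions of a dyadic block is discretised by Gallagher's inequality over 1/M-separated primitive
directions). Supports: X1 → NeedleFamilyFat (same proof), HeckeMobiusPointwise (k fixed; provable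
now from the in-tree GaussianHecke bricks) → NeedleFixed, DirectionGallagher. The Assembly ends at
NeedleFamilyHalf ∧ NeedleFamilyFat ∧ NeedleFixed, NOT at Summit.Parity.BatemanHorn: by the pencil
reading (needle sum = Σ_j cofactor atoms of X²+j² at modulus a²+c²) these items are family averages,
invariant under changing μ on the Landau norms {m²+1} up to O(N log²N) — the route's value is
closing three items and retiring the 'unit width = Hecke threshold' diagnosis, not parity.
Lean: `∀ Φ : ℝ → ℝ, ContDiff ℝ ((⊤ : ℕ∞) : WithTop ℕ∞) Φ → tsupport Φ ⊆ Set.Icc (1 / 2 : ℝ) 3 → ∀ ε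
: ℝ, 0 < ε → ∃ X₀ : ℝ, ∀ X : ℝ, X₀ ≤ X → ∑ k ∈ Finset.range (⌊X ^ (11 / 20 : ℝ)⌋₊ + 1), ‖∑ z ∈
Literature.NumberTheory.LFunctions.GaussianInt.normLE (3 * X), (ArithmeticFunction.moebius
z.norm.natAbs : ℂ) * ((Φ ((z.norm : ℝ) / X) : ℝ) : ℂ) *
Literature.NumberTheory.LFunctions.GaussianInt.angularChar k z‖ ^ 2 ≤ ε * X ^ 2`

## Assembly
Pure logic (proved as `assembly_holds` in the planner's Sketch.lean): modus ponens twice for the two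
reductions from SectorMobiusMeanSquare, once for the fixed needle. The conclusion is the conjunction
of the three shared UnimodularColumns items; nothing here reaches
Literature.NumberTheory.Sieve.HardyLittlewoodConjE (see Thesis: the items are parity-vacuous), so
the route is an engine, to be closed `superseded`/`done` once 0883–0885 close.

Rationale: WHY THIS LINE. HuangLiuRudnick2020 (arXiv:1903.04005) Thm 4 bounds the variance of Λ over sectors of
width 1/K, K = X^τ, τ < 3/5, by (log X)^{-A}·mean², from Ricci's zero-density theorem for the family
L(s, λ^k), 0 < k ≤ K (Thm 3: N(σ;T,K) ≪ T K^{(10/3)(1−σ)}(log K)^B) and Kubilius' zero-free region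
(Thm 2); in Parseval form this is Σ_{0<k≲K} |S_k(Λ)|² ≪ X²(log X)^{-A} (proof, p.5). The planner and
grounders of UnimodularColumns read the needle items POINTWISE (unit width = X^{-1/2} =
GRH/forbidden-region threshold, HLR p.3), but 0883/0884 are L¹ averages over ≍ M needles per dyadic
height M whose directions (longer columns of γ, primitive vectors) are 1/M-separated by |det| ≥ 1:
almost-all statements at exponent ρ ≤ 1/2, a full step inside the printed almost-all range 3/5.
Imported: Hecke Grössencharakter L-functions of ℚ(i) (in tree:
Literature.NumberTheory.LFunctions.GaussianHecke.*, heckeL continuation and non-vanishing on Re s =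
1 PROVED), zero-density / Hecke-polynomial mean-value technology (HLR2020; Järviniemi–Teräväinen
arXiv:2303.05822 Lemmas 3.2–3.3, Heath-Brown identity for Hecke polynomials §3, large values §5 —
their Remark 1.3 flags the multiplicative-function analogue as expected but unwritten), and
Gallagher's Sobolev inequality (Montgomery1971 §1; Gallagher1970) from the large sieve. The Λ → μ∘N
transcription uses Σ_𝔞 μ(N𝔞)λ^k(𝔞)N𝔞^{-s} = G_k(s)/L(s,λ^k) with G_k an Euler product absolutely
convergent and bounded with its inverse on Re s ≥ 1/2+ε uniformly in k (split p ≥ 5 > 2²), or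
directly Heath-Brown's identity for μ_K. No prior route or negative touches these items' proofs;
UnimodularColumns' kill criterion ('0883 refuted while 0884 holds ⇒ the SL₂ average adds nothing
beyond Hecke') is replaced by its mirror image: 0883 is PROVED by Hecke-side zero density.

RANKED CRUXES. #0 NeedleFamilyHalf (target) — verbatim stmt-Parity-0883
(UnimodularColumns.NeedleFamilyHalf): Σ_{γ ∈ SL₂(ℤ), ‖γ‖² ≤ N} |Σ_{0 < |u|² ≤ N} μ(|γu|²)| = o(N²).
(why it might fail: only with SectorMobiusMeanSquare: an Ω-result Σ_γ|·| ≫ N² would need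
positive-proportion correlation of μ∘N with ≍X^{1/2} angular characters (contradicts GRH);
numerically untested beyond the card's proposal.) [HuangLiuRudnick2020, arXiv:2303.05822,
Harman2007, stmt-Parity-0883]
#2 SectorMobiusMeanSquare (crux) — (card K1, character form) for every smooth Φ : ℝ → ℝ with
tsupport ⊆ [1/2, 3] and every ε > 0 there is X₀ such that for all real X ≥ X₀: Σ_{k=0}^{⌊X^{11/20}⌋}
|Σ_{z ∈ ℤ[i], N z ≤ 3X} μ(N z) Φ(N z/X) λ^k(z)|² ≤ ε X² (sum over all Gaussian integers, four
associates each; k = 0 is the Möbius prime-ideal theorem for ℚ(i); trivial bound ≍ X^{51/20},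
GRH/random-model size ≍ X^{31/20}). [difficulty: XL] (why it might fail: Λ→μ at k-aspect is
unwritten: the explicit formula is replaced by 1/L bounds off zero neighbourhoods
(Borel–Carathéodory losses exp((log X)^θ)) or by Heath-Brown+MVT/LVT for Hecke polynomials (JT
§3–5); a log-power loss near σ=1 could cap k at X^(1/2−δ), below the needed 11/20.)
[HuangLiuRudnick2020, arXiv:2303.05822, ColemanMathematika1990, Harman2007, MontgomeryVaughan2007,
doi:10.4064/aa-31-4-313-324, MatomakiRadziwillAnnals2016]
#3 NeedleReductionHalf (crux) — SectorMobiusMeanSquare → NeedleFamilyHalf. Proof plan (card K2–K3,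
checked in NOTES): (i) taper: for γ with ‖γ‖² ∈ (M_i,(1+η)M_i] the indicator of γ(B_√N) agrees with
Σ_j Φ_η(Nz/X_j)·W_ij(arg z − φ_γ) (radial partition of unity from ONE bump Φ_η; angular window
1_[−α,α] ∗ ρ_(cηα), α = α_ij ≍ √(N/(M_i X_j))) outside the shell | |γ⁻¹z|² − N | ≤ CηN, which holds
O(ηN) lattice points independently of γ; (ii) φ_γ = arg(longer column) + O(1/M), distinct primitive
columns are 1/M-separated (|det| ≥ 1), so Gallagher gives Σ_γ |G_ij(φ_γ)|² ≤ C(M_i‖G‖₂² +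
‖G‖₂‖G′‖₂); (iii) Parseval: only frequencies 4k survive, ‖G‖₂² ≤ C α² Σ_{k ≤ X^{1/40}/(cηα)} |S_k|²
+ tail, and X^{1/40}/(cηα) ≤ X_j^{11/20}; (iv) Cauchy–Schwarz over the ≍ ηM_i matrices of the group
and summation over j, i give Σ_γ|S(γ)| ≪ √ε η^{-3/2} N² + CηN², then η → 0. [deps:
SectorMobiusMeanSquare, DirectionGallagher] [difficulty: L] (why it might fail: unit-width needles
(M≍N) have sub-lattice angular resolution: the smoothing ramps cηα and the O(1/M) offset of φ_γ from
arg(column) sit at the separation scale 1/M, so a constant lost in Gallagher/taper at the tip X≍MN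
(where the mass concentrates) could leave O(N²) instead of o(N²).) [Montgomery1971, Gallagher1970,
HuangLiuRudnick2020, arXiv:2303.05822, Iwaniec2002]
#9 NeedleFamilyFat (support) — verbatim stmt-Parity-0884 (UnimodularColumns.NeedleFamilyFat): for
every θ ∈ (0,1), Σ_{‖γ‖² ≤ N^θ} |Σ_{0<|u|² ≤ N^{2−θ}} μ(|γu|²)| = o(N²). [difficulty: L]
[stmt-Parity-0884, HuangLiuRudnick2020, Harman2007]
#9 NeedleReductionFat (support) — SectorMobiusMeanSquare → NeedleFamilyFat: the same reduction with
R² = N^{2−θ}, M ≤ N^θ, α = R/√(MX) (exponent ρ ≤ θ/2 < 1/2), K = X^{1/40}√(MX)/(cηR) ≤ X^{11/20};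
total ≪ √ε η^{-3/2} N². [difficulty: L] [HuangLiuRudnick2020, Montgomery1971]
#9 HeckeMobiusPointwise (support) — for every fixed k ∈ ℕ, Σ_{z ∈ ℤ[i], N z ≤ X} μ(N z) λ^k(z) =
o(X) as X → ∞. Provable now from the in-tree bricks: ψ-form twisted prime ideal theorem
`Literature.NumberTheory.LFunctions.GaussianHecke.sum_lCoeff_isLittleO` (k ≥ 1) /
`sum_re_lCoeff_zero_sub_isLittleO` (k = 0) + Landau's identity (μλ^k)·log = −(μλ^k) ∗ (Λλ^k) +
partial summation, then the Euler-factor correction from μ_K to μ∘N (absolutely convergent on Re s >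
1/2). The fact grounders marked WANTED for 0884/0885. [difficulty: M] [HeckeMathZ1920, Harman2007,
MontgomeryVaughan2007, Landau1903]
#9 NeedleFixed (support) — verbatim stmt-Parity-0885 (UnimodularColumns.NeedleFixed): for every γ ∈
SL₂(ℤ), Σ_{0 < u²+v² ≤ N} μ(|γ(u,v)|²) = o(N). [difficulty: M] [stmt-Parity-0885, HeckeMathZ1920,
Landau1903]
#9 FixedNeedleReduction (support) — HeckeMobiusPointwise → NeedleFixed: a fixed ellipse shape
√N·γ(B₁) is, up to a boundary layer of O(η′N) lattice points, a finite union of polar boxes with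
smooth angular partitions of unity; truncating their Fourier series at |n| ≤ L(ε′) costs ε′·O(N);
frequencies n ≢ 0 (mod 4) vanish by the symmetry z ↦ iz; the finitely many remaining sums are o(N)
by HeckeMobiusPointwise (sharp radial cut-offs allowed there). [difficulty: M] [HeckeMathZ1920,
Harman2007]
#9 DirectionGallagher (support) — Gallagher's inequality over primitive lattice directions: there is
C such that for every M ≥ 1 and every 2π-periodic C¹ function g, Σ over primitive v ∈ ℤ² with M/2 <
|v|² ≤ M of |g(arg v)|² ≤ C·(M ∫₀^{2π} |g|² + ∫₀^{2π} |g||g′|) (the points arg v are 1/M-separated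
mod 2π since |sin∠(v,v′)| = |det(v,v′)|/(|v||v′|) ≥ 1/M; Montgomery1971 Lemma 1.4 with δ = 1/M gives
C = 1). [difficulty: provable-now] [Montgomery1971, Gallagher1970]

TWO-LAYER PLAN. Foreseen glued splits (k ≤ 3, depth 1), filed only after a crux closes or a fact
lands: SectorMobiusMeanSquare ⇐ [HeckeFamilyZeroDensity (Ricci/HLR Thm 3 + Kubilius Thm 2 as
vendored Literature facts, requested below) → MobiusOffZeros (1/L(s,λ^k) ≪ (kT)^{o(1)} right of the
zero clusters, or the Heath-Brown/MVT/LVT route of arXiv:2303.05822 §3–5) → SectorMobiusMeanSquare];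
NeedleReductionHalf ⇐ [NeedleTaper (ellipse vs. radial-partition × angular-window, O(ηN) shell
count, elementary geometry of numbers) → NeedleParsevalGallagher (DirectionGallagher + Parseval
bookkeeping) → NeedleReductionHalf]. HeckeMobiusPointwise may split k = 0 (ζ_ℚ(i)) / k ≥ 1.

KILL CRITERIA. SectorMobiusMeanSquare refuted as stated (an Ω(X²) lower bound for the k ≤ X^{11/20}
mean square — this contradicts GRH, so in practice: a refuter showing the stated uniformity class
'all smooth Φ ⊂ [1/2,3]' or the sharp k cut-off is wrong) ⇒ restate (smooth k-weights, Φ-dependent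
X₀ are already allowed) — pivot, not close. A grounder/refuter showing that every known Λ→μ
transcription at k-aspect loses X^δ (so that k ≤ X^{1/2+δ} is out of reach of Ricci/HLR/JT
technology) ⇒ the engine stalls: close `exhausted` with census and hand 0883 back to
UnimodularColumns as genuinely open at almost-all strength. NeedleFamilyHalf refuted numerically or
by theorem (kit: Σ_γ|S(γ)|/N² not decaying) ⇒ both this route and UnimodularColumns' r3 die: close
`refuted:NeedleFamilyHalf`. 0883–0885 proved by any other means ⇒ close `superseded`.

NOT DECOMPOSED YET. The (log X)^{-A} rate (only o(1) is asked); the Matomäki–Radziwiłł range k ≤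
X^{1−ε} in sectors (card K5, JT Remark 1.3 — theorem-candidate, not needed); sharp-sector and
sharp-annulus variants of SectorMobiusMeanSquare; general discriminants / class number > 1
(UnimodularColumns' general-f remark); the parity-vacuity lemma Σ_γ #{u : |γu|² − 1 = □} ≪ N log²N
(documentary, provable, not load-bearing); any glue from the needle items to WindowW/CofactorAvg
(there is none — by design).

CHEAPEST FALSIFIER. kit numerics, two observables: (a) V(X) := X^{-2} Σ_{0≤k≤X^{0.55}} |Σ_{N z≤3X}
μ(N z)Φ(N z/X)λ^k(z)|² for X = 10⁴…10⁷ with one fixed bump Φ (angular FFT of μ∘N binned at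
resolution ≪ X^{-0.55}): prediction V(X) ≍ X^{-0.45+o(1)} (diagonal K·X/X²); a plateau would refute
SectorMobiusMeanSquare as normalised. (b) Σ_{‖γ‖²≤N} |Σ_{0<|u|²≤N} μ(|γu|²)| / N² for N ≤ 2·10⁵ via
LagrangeDictionary enumeration: should decay (slowly, like (log N)^{-c} or better); growth refutes
0883 itself. Lookup falsifier already run: JT arXiv:2303.05822 Remark 1.3 confirms the
multiplicative-function almost-all-sector theorem is not in print (so r2 is not `known`), and HLR
Thm 1/4 confirm 3/5 > 11/20.

NUMBERS. Needle γ(B_√N), ‖γ‖² = M: semi-axes √(MN), √(N/M); angular half-width at norm X: √(N/(MX))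
≥ X^{-1/2} (ρ ≤ 1/2); fat family: ρ ≤ θ/2. Printed ranges (HLR2020 pp.3–5): pointwise asymptotics ρ
< 3/10 (Ricci 1976), GRH pointwise ρ < 1/2, forbidden regions at ρ = 1/2, almost-all ρ < 3/5 (Thm
1), variance saving (log X)^{-A} for K = X^τ, τ < 3/5 (Thm 4), zero density N(σ;T,K) ≪ T
K^{(10/3)(1−σ)}(log K)^B (Thm 3), zero-free 1−β ≫ (log V loglog V)^{-3/4} (Thm 2); Harman–Lewis
lower bounds to X^{-0.381} (Harman2007 Thm 11.2); JT2024: E₂ in almost all sectors of area (log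
X)^C, E₃ at (log X)(loglog X)^C; MVT for Hecke polynomials Σ_{|m|≤T}|F(m)|² ≪ (N+T)Σ′|a′_n|² (JT
Lemma 3.2 = Harman2007 Ch. 11). K1 exponent 11/20; k-range actually consumed by the reduction:
X^{1/2+1/40}/(cη). Sizes: trivial Σ_k|S_k|² ≍ X^{2.55}, diagonal ≍ X^{1.55}, asked o(X²). Items at
open: 10 (1 target, 2 cruxes, 6 support, 1 assembly).

DEFINITION REQUESTS. No new notions (Literature.NumberTheory.LFunctions.GaussianInt.normLE /
angularChar exist). Cite facts wanted as hypotheses for the layer-2 split of SectorMobiusMeanSquare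
(to be filed as `--kind cite` items): (F1) Ricci's zero-density theorem for {L(s,λ^k)}_{0<k≤K} =
HuangLiuRudnick2020 Thm 3 (p.4); (F2) Kubilius' zero-free region = HuangLiuRudnick2020 Thm 2 (p.4)
(cf. ColemanMathematika1990; in tree only via harman_primeCharSum_bound); (F3) the mean value
theorem for Hecke polynomials, arXiv:2303.05822 Lemma 3.2 (= Harman2007 Ch. 11); optionally (F4) HLR
Thm 4 itself (Λ-variance) as a named fact for calibration.

Novelty: Searches (2026-08-15; local searchd rc 75 all session, OpenAlex/S2/arXiv HTTP 429): `lit search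
--source zbmath "Gaussian primes sectors"` (14: HuangLiuRudnick2020, HarmanLewis2001,
Järviniemi–Teräväinen arXiv:2303.05822 = Rev. Mat. Iberoam. 40 (2024), Stucky arXiv:2008.11325,
Zarzycki 1991 doi:10.1016/s0022-314x(05)80032-0, Maknys 1983 doi:10.1007/bf01960557, Chow–Pomerance
arXiv:1703.10953, Harman 2019 doi:10.1093/qmathj/haz038); `lit search --source zbmath "Möbius
function Gaussian integers sectors"` and `"… narrow sectors almost all Hecke characters zero
density"` (0 each); `lit vsearch` (12 docs: only Harman2007 p.244 relevant); `lit galaxy search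
"Gaussian primes in narrow sectors" --star all` (3 rows: Harman's book, Baier–Zhao math/0701577, one
popular book); `lit read arXiv:1903.04005` pp.3–5 (Thms 1–4, proof of Thm 4) and `lit read
arXiv:2303.05822` pp.3–5, 7–9 (Thms 1.1–1.2, Lemma 2.2 reduction, Lemmas 3.2–3.3, Remark 1.3);
ledger notes of stmt-Parity-0883/0884 (grounders g9-2/g9-4/reground: 'Möbius analogue by the same
zero-density argument, not printed as such'); all six BatemanHorn route files.
Nearest prior art found: HuangLiuRudnick2020 Thms 1/3/4 (Λ in almost all sectors, ρ < 3/5, zero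
density) and arXiv:2303.05822 (Hecke-polynomial MVT/LVT/Heath-Brown toolkit for almost-all sectors;
Remark 1.3: the multiplicative-function analogue has 'no fundamental obstacle' but is not done); for
the transcription template Motohashi/Ramachandra 1976 (doi:10.4064/aa-31-4-313  [refs: 10.1016/s0022-314x(05, 10.1007/bf01960557, 10.1093/qmathj/haz038, 10.4064/aa-31-4-313-324, 2303.05822, 2008.11325, 1703.10953, 1903.04005, doi:10.1016/s0022-314x, doi:10.1007/bf01960557, doi:10.1093/qmathj/haz038, doi:10.4064/aa-31-4-313-324, HuangLiuRudnick2020, HarmanLewis2001, Harman2007, MatomakiRadziwillAnnals2016, Gallagher1970, Montgomery1971]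

Barriers (technique_class: hecke-zero-density almost-all-sectors discretisation): - technique_class: hecke-zero-density almost-all-sectors discretisation
- Literature.Barriers.Parity.SelbergParityBarrier: not engaged — no prime count or lower bound for a
sifted set is produced; the targets are L¹ family averages of μ∘N over 2-dimensional regions of
ℤ[i], invariant (up to O(N log²N)) under flipping μ on the Landau norms {m²+1}, so no parity
information about n²+1 is claimed; the input is zero density for Hecke L-functions, not sieve
axioms.
- Literature.Barriers.Parity.FordMaynardLowLevel: not engaged — no Type-I/II decomposition of the
thin value set {n²+1} (c = 1/2); Heath-Brown/Vaughan identities, if used inside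
SectorMobiusMeanSquare, decompose μ_K over ALL ideals of ℤ[i] (a density-one set in its own ring),
where zero-density/mean-value theorems act.
- Literature.Barriers.Parity.FordMaynardMinimalTypeII: same — nothing here detects primes in a thin
integer sequence; consistent with FM: the items are parity-vacuous for HL-E.
- Literature.Barriers.Parity.LargeSieveLevelHalf: the only large-sieve-type input is Gallagher's
inequality for 1/M-separated directions (M ≤ N) against an L² integral that already carries the
zero-density saving; used at trivial strength, no level of distribution beyond 1/2 of anything is
asserted.
- Literature.Barriers.Parity.RedactedPrimes: consistent and sharpened — pointwise unit-width sectors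
are exactly the X^{-1/2}-slack regime invisible to L²/large-sieve information; the route only claims
the almost-all statement (exception

History (route lifecycle, newest last):
- 2026-08-15T13:50:09Z · CLOSED retired — not-a-thesis: assembly does not conclude the sub-problem Statement (operator:999:1257524)

sub-problem: BatemanHorn · status: closed(retired) · opened planner-plancard-Parity-BatemanHorn-needle-fa-feb574ab-0 2026-08-15T12:19:30Z · rev 0 · ledger route-Parity-NeedleSectors
GENERATED by the gate from the ledger (D-0016/17). Provers cite these decls: `theorem foo : Summit.Parity.BatemanHorn.Theses.NeedleSectors.<Decl> := …` in Summits/Parity/BatemanHorn/Theorems/<Name>.lean.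
-/

namespace Summit.Parity.BatemanHorn.Theses.NeedleSectors

open scoped BigOperators Topology Manifold Classical MeasureTheory ProbabilityTheory Matrix InnerProductSpace ComplexConjugate ContinuousMap
open Filter Set Function TopologicalSpace MeasureTheory

attribute [summit_statement] _root_.BatemanHorn

/-- item stmt-Parity-0883 · target · rank 0 · closed · moot by None · by planner
why it might fail: only with SectorMobiusMeanSquare: an Ω-result Σ_γ|·| ≫ N² would need positive-proportion correlation of μ∘N with ≍X^{1/2} angular characters (contradicts GRH); numerically untested beyond the card's proposal.
sources: HuangLiuRudnick2020, arXiv:2303.05822, Harman2007, stmt-Parity-0883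
[crux] Unit-width needle family (height Y = √x, here x = N²): ∑_{γ ∈ SL₂(ℤ), ‖γ‖² ≤ N} |∑_{u ∈ ℤ², 0
< |u|² ≤ N} μ(|γu|²)| = o(N²). For each γ the inner sum is Möbius of the norm over the Gaussian
integers v = γu in the ellipse γ(B_√N) of area πN, length ≍ N and width ≍ 1 (e.g. γ = (1 t; 0 1):
∑_{|v| ≤ √N} ∑_{|w − tv| ≲ √N} μ(w² + v²), intervals of length ≍ √w); ≍ N needles, total mass ≍ N².
Threshold member of the family NeedleFamilyFat (θ<1, Hecke territory) — NeedleFamilyHalf (θ=1) —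
UnimodularMobius (θ=2). Open. Sources: Hecke1920 (Gaussian primes in sectors),
DukeFriedlanderIwaniec1995, MarklofWelsh2023. -/
@[route_item "route-Parity-NeedleSectors"]
def NeedleFamilyHalf : Prop :=
  (fun N : ℕ => ∑ a ∈ Finset.Icc (-(N : ℤ)) N, ∑ b ∈ Finset.Icc (-(N : ℤ)) N, ∑ c ∈ Finset.Icc (-(N : ℤ)) N, ∑ d ∈ Finset.Icc (-(N : ℤ)) N, if a * d - b * c = 1 ∧ a ^ 2 + b ^ 2 + c ^ 2 + d ^ 2 ≤ (N : ℤ) then |∑ u ∈ Finset.Icc (-(N : ℤ)) N, ∑ v ∈ Finset.Icc (-(N : ℤ)) N, if 0 < u ^ 2 + v ^ 2 ∧ u ^ 2 + v ^ 2 ≤ (N : ℤ) then (ArithmeticFunction.moebius ((a * u + b * v) ^ 2 + (c * u + d * v) ^ 2).toNat : ℝ) else 0| else 0) =o[Filter.atTop] fun N : ℕ => (N : ℝ) ^ 2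

/-- item stmt-Parity-7884 · crux · rank 2 · closed · moot by None · by planner
why it might fail: Λ→μ at k-aspect is unwritten: the explicit formula is replaced by 1/L bounds off zero neighbourhoods (Borel–Carathéodory losses exp((log X)^θ)) or by Heath-Brown+MVT/LVT for Hecke polynomials (JT §3–5); a log-power loss near σ=1 could cap k at X^(1/2−δ), below the needed 11/20.
sources: HuangLiuRudnick2020, arXiv:2303.05822, ColemanMathematika1990, Harman2007, MontgomeryVaughan2007, doi:10.4064/aa-31-4-313-324
[crux] (card K1, character form) for every smooth Φ : ℝ → ℝ with tsupport ⊆ [1/2, 3] and every ε > 0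
there is X₀ such that for all real X ≥ X₀: Σ_{k=0}^{⌊X^{11/20}⌋} |Σ_{z ∈ ℤ[i], N z ≤ 3X} μ(N z) Φ(N
z/X) λ^k(z)|² ≤ ε X² (sum over all Gaussian integers, four associates each; k = 0 is the Möbius
prime-ideal theorem for ℚ(i); trivial bound ≍ X^{51/20}, GRH/random-model size ≍ X^{31/20}).
[difficulty: XL] -/
@[route_item "route-Parity-NeedleSectors"]
def SectorMobiusMeanSquare : Prop :=
  ∀ Φ : ℝ → ℝ, ContDiff ℝ ((⊤ : ℕ∞) : WithTop ℕ∞) Φ → tsupport Φ ⊆ Set.Icc (1 / 2 : ℝ) 3 → ∀ ε : ℝ, 0 < ε → ∃ X₀ : ℝ, ∀ X : ℝ, X₀ ≤ X → ∑ k ∈ Finset.range (⌊X ^ (11 / 20 : ℝ)⌋₊ + 1), ‖∑ z ∈ Literature.NumberTheory.LFunctions.GaussianInt.normLE (3 * X), (ArithmeticFunction.moebius z.norm.natAbs : ℂ) * ((Φ ((z.norm : ℝ) / X) : ℝ) : ℂ) * Literature.NumberTheory.LFunctions.GaussianInt.angularChar k z‖ ^ 2 ≤ ε * X ^ 2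

/-- item stmt-Parity-7885 · crux · rank 3 · closed · moot by None · by planner
why it might fail: unit-width needles (M≍N) have sub-lattice angular resolution: the smoothing ramps cηα and the O(1/M) offset of φ_γ from arg(column) sit at the separation scale 1/M, so a constant lost in Gallagher/taper at the tip X≍MN (where the mass concentrates) could leave O(N²) instead of o(N²).
sources: Montgomery1971, Gallagher1970, HuangLiuRudnick2020, arXiv:2303.05822, Iwaniec2002
[crux] SectorMobiusMeanSquare → NeedleFamilyHalf. Proof plan (card K2–K3, checked in NOTES): (i)
taper: for γ with ‖γ‖² ∈ (M_i,(1+η)M_i] the indicator of γ(B_√N) agrees with Σ_j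
Φ_η(Nz/X_j)·W_ij(arg z − φ_γ) (radial partition of unity from ONE bump Φ_η; angular window 1_[−α,α]
∗ ρ_(cηα), α = α_ij ≍ √(N/(M_i X_j))) outside the shell | |γ⁻¹z|² − N | ≤ CηN, which holds O(ηN)
lattice points independently of γ; (ii) φ_γ = arg(longer column) + O(1/M), distinct primitive
columns are 1/M-separated (|det| ≥ 1), so Gallagher gives Σ_γ |G_ij(φ_γ)|² ≤ C(M_i‖G‖₂² +
‖G‖₂‖G′‖₂); (iii) Parseval: only frequencies 4k survive, ‖G‖₂² ≤ C α² Σ_{k ≤ X^{1/40}/(cηα)} |S_k|²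
+ tail, and X^{1/40}/(cηα) ≤ X_j^{11/20}; (iv) Cauchy–Schwarz over the ≍ ηM_i matrices of the group
and summation over j, i give Σ_γ|S(γ)| ≪ √ε η^{-3/2} N² + CηN², then η → 0. [deps:
SectorMobiusMeanSquare, DirectionGallagher] [difficulty: L] -/
@[route_item "route-Parity-NeedleSectors"]
def NeedleReductionHalf : Prop :=
  SectorMobiusMeanSquare → NeedleFamilyHalf

/-- item stmt-Parity-0884 · support · rank 9 · closed · moot by None · by planner
sources: stmt-Parity-0884, HuangLiuRudnick2020, Harman2007
[support] Fat needle family: for every θ ∈ (0,1), ∑_{γ ∈ SL₂(ℤ), ‖γ‖² ≤ N^θ} |∑_{0 < |u|² ≤ N^{2−θ}}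
μ(|γu|²)| = o(N²) (needles γ(B_ρ), ρ² = N^{2−θ}, have width ≍ N^{1−θ} → ∞, so each inner sum is
Möbius of the norm over Gaussian integers in a genuinely 2-dimensional region; expected provable
from the prime ideal theorem / Hecke Grössencharakter L-functions for ℚ(i) with error terms uniform
in the eccentricity N^θ, harder as θ → 1). Grounders: record the largest θ covered by the literature
(Kubilius / Coleman-type sector theorems) as a Literature fact. -/
@[route_item "route-Parity-NeedleSectors"]
def NeedleFamilyFat : Prop :=
  ∀ θ : ℝ, 0 < θ → θ < 1 → (fun N : ℕ => ∑ a ∈ Finset.Icc (-(N : ℤ)) N, ∑ b ∈ Finset.Icc (-(N : ℤ)) N, ∑ c ∈ Finset.Icc (-(N : ℤ)) N, ∑ d ∈ Finset.Icc (-(N : ℤ)) N, if a * d - b * c = 1 ∧ ((a ^ 2 + b ^ 2 + c ^ 2 + d ^ 2 : ℤ) : ℝ) ≤ (N : ℝ) ^ θ then |∑ u ∈ Finset.Icc (-((N : ℤ)) ^ 2) ((N : ℤ) ^ 2), ∑ v ∈ Finset.Icc (-((N : ℤ)) ^ 2) ((N : ℤ) ^ 2), if 0 < u ^ 2 + v ^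 2 ∧ ((u ^ 2 + v ^ 2 : ℤ) : ℝ) ≤ (N : ℝ) ^ (2 - θ) then (ArithmeticFunction.moebius ((a * u + b * v) ^ 2 + (c * u + d * v) ^ 2).toNat : ℝ) else 0| else 0) =o[Filter.atTop] fun N : ℕ => (N : ℝ) ^ 2

/-- item stmt-Parity-0885 · support · rank 9 · closed · moot by None · by planner
sources: stmt-Parity-0885, HeckeMathZ1920, Landau1903
[support] One fixed needle: for every (a b; c d) ∈ SL₂(ℤ), ∑_{0 < u²+v² ≤ N} μ((au+bv)² + (cu+dv)²)
= o(N). Since u ↦ γu is a bijection of ℤ² this is ∑ μ(N(z)) over Gaussian integers z in the fixed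
ellipse γ(B_√N): the prime ideal theorem for ℤ[i] in a fixed smooth region (Landau1903 / Hecke1920).
Provable given PNT-for-ℤ[i]-type Literature facts; the base case θ → 0 of the needle family. -/
@[route_item "route-Parity-NeedleSectors"]
def NeedleFixed : Prop :=
  ∀ a b c d : ℤ, a * d - b * c = 1 → (fun N : ℕ => ∑ u ∈ Finset.Icc (-(N : ℤ)) N, ∑ v ∈ Finset.Icc (-(N : ℤ)) N, if 0 < u ^ 2 + v ^ 2 ∧ u ^ 2 + v ^ 2 ≤ (N : ℤ) then (ArithmeticFunction.moebius ((a * u + b * v) ^ 2 + (c * u + d * v) ^ 2).toNat : ℝ) else 0) =o[Filter.atTop] fun N : ℕ => (N : ℝ)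

/-- item stmt-Parity-7886 · support · rank 9 · closed · moot by None · by planner
sources: HuangLiuRudnick2020, Montgomery1971
[support] SectorMobiusMeanSquare → NeedleFamilyFat: the same reduction with R² = N^{2−θ}, M ≤ N^θ, α
= R/√(MX) (exponent ρ ≤ θ/2 < 1/2), K = X^{1/40}√(MX)/(cηR) ≤ X^{11/20}; total ≪ √ε η^{-3/2} N².
[difficulty: L] -/
@[route_item "route-Parity-NeedleSectors"]
def NeedleReductionFat : Prop :=
  SectorMobiusMeanSquare → NeedleFamilyFat

/-- item stmt-Parity-7887 · support · rank 9 · closed · moot by None · by planner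
sources: HeckeMathZ1920, Harman2007, MontgomeryVaughan2007, Landau1903
[support] for every fixed k ∈ ℕ, Σ_{z ∈ ℤ[i], N z ≤ X} μ(N z) λ^k(z) = o(X) as X → ∞. Provable now
from the in-tree bricks: ψ-form twisted prime ideal theorem
`Literature.NumberTheory.LFunctions.GaussianHecke.sum_lCoeff_isLittleO` (k ≥ 1) /
`sum_re_lCoeff_zero_sub_isLittleO` (k = 0) + Landau's identity (μλ^k)·log = −(μλ^k) ∗ (Λλ^k) +
partial summation, then the Euler-factor correction from μ_K to μ∘N (absolutely convergent on Re s >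
1/2). The fact grounders marked WANTED for 0884/0885. [difficulty: M] -/
@[route_item "route-Parity-NeedleSectors"]
def HeckeMobiusPointwise : Prop :=
  ∀ k : ℕ, (fun X : ℝ => ∑ z ∈ Literature.NumberTheory.LFunctions.GaussianInt.normLE X, (ArithmeticFunction.moebius z.norm.natAbs : ℂ) * Literature.NumberTheory.LFunctions.GaussianInt.angularChar k z) =o[Filter.atTop] fun X : ℝ => (X : ℂ)

/-- item stmt-Parity-7888 · support · rank 9 · closed · moot by None · by planner
sources: HeckeMathZ1920, Harman2007
[support] HeckeMobiusPointwise → NeedleFixed: a fixed ellipse shape √N·γ(B₁) is, up to a boundary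
layer of O(η′N) lattice points, a finite union of polar boxes with smooth angular partitions of
unity; truncating their Fourier series at |n| ≤ L(ε′) costs ε′·O(N); frequencies n ≢ 0 (mod 4)
vanish by the symmetry z ↦ iz; the finitely many remaining sums are o(N) by HeckeMobiusPointwise
(sharp radial cut-offs allowed there). [difficulty: M] -/
@[route_item "route-Parity-NeedleSectors"]
def FixedNeedleReduction : Prop :=
  HeckeMobiusPointwise → NeedleFixed

/-- item stmt-Parity-7889 · support · rank 9 · closed · moot by None · by planner
sources: Montgomery1971, Gallagher1970
[support] Gallagher's inequality over primitive lattice directions: there is C such that for every M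
≥ 1 and every 2π-periodic C¹ function g, Σ over primitive v ∈ ℤ² with M/2 < |v|² ≤ M of |g(arg v)|²
≤ C·(M ∫₀^{2π} |g|² + ∫₀^{2π} |g||g′|) (the points arg v are 1/M-separated mod 2π since |sin∠(v,v′)|
= |det(v,v′)|/(|v||v′|) ≥ 1/M; Montgomery1971 Lemma 1.4 with δ = 1/M gives C = 1). [difficulty:
provable-now] -/
@[route_item "route-Parity-NeedleSectors"]
def DirectionGallagher : Prop :=
  ∃ C : ℝ, ∀ M : ℕ, 1 ≤ M → ∀ g : ℝ → ℂ, Function.Periodic g (2 * Real.pi) → ContDiff ℝ 1 g → ∑ v ∈ ((Finset.Icc (-(M : ℤ)) M) ×ˢ (Finset.Icc (-(M : ℤ)) M)).filter (fun v : ℤ × ℤ => Int.gcd v.1 v.2 = 1 ∧ (M : ℤ) < 2 * (v.1 ^ 2 + v.2 ^ 2) ∧ v.1 ^ 2 + v.2 ^ 2 ≤ (M : ℤ)), ‖g (Complex.arg ((v.1 : ℂ) + (v.2 : ℂ) * Complex.I))‖ ^ 2 ≤ C * ((M : ℝ) * ∫ θ in (0 : ℝ)..(2 * Real.pi), ‖g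 θ‖ ^ 2 + ∫ θ in (0 : ℝ)..(2 * Real.pi), ‖g θ‖ * ‖deriv g θ‖)

/-- item stmt-Parity-7890 · assembly · rank 1 · closed · moot by None · by planner
sources: HuangLiuRudnick2020, stmt-Parity-0883
[assembly] SectorMobiusMeanSquare → NeedleReductionHalf → NeedleReductionFat → HeckeMobiusPointwise
→ FixedNeedleReduction → (NeedleFamilyHalf ∧ NeedleFamilyFat ∧ NeedleFixed). -/
@[route_item "route-Parity-NeedleSectors"]
def Assembly : Prop :=
  SectorMobiusMeanSquare → NeedleReductionHalf → NeedleReductionFat → HeckeMobiusPointwise → FixedNeedleReduction → (NeedleFamilyHalf ∧ NeedleFamilyFat ∧ NeedleFixed)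

end Summit.Parity.BatemanHorn.Theses.NeedleSectors
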